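import Mathlib
import Literature.Analysis.FluidPDE.GalerkinFlow
import HarnessLib

/-!
# Stub `stub_blockToWindow` of line `Sketch` — crux `WazewskiBlock.UniformGalerkinTrap`
# (stmt-AnomalousDissipation-10352)

Sorry-free discharge of the registered stub `stub_blockToWindow` of the lead's skeleton
(`Cruxes/UniformGalerkinTrap/Lines/Sketch.lean`): the **phase point ⟶ field window** plumbing.

Setting: `S = freqBall N ⊆ ℤ³`, the Galerkin phase space `X = ↥(galerkinSubspace S)` of real
divergence-free coefficient vectors, the phase semiflow `Φ = galerkinPhaseFlow ν (f̂|_S)`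
(`Literature/Analysis/FluidPDE/GalerkinFlow.lean`). If the forward orbit `Φ t x`, `t ≥ 0`, of a
phase point `x` stays in the coefficient block
`{½ ∑ ‖c k‖² ≤ E} ∩ {∑ Re ⟪f̂ k, c k⟫ ≥ ε₀} ∩ {4π² ∑ |k|² ‖c k‖² ≤ G}`, then the synthesised field
`a = realTrigPoly S x̄` is a Galerkin mode of order `N` and its field orbit
`Torus.galerkinFlow ν f N t a` stays in the window
`{kineticEnergy ≤ E} ∩ {∫ ⟪f, ·⟫ ≥ ε₀} ∩ {eGradNormSq ≤ G}`.

**Proof.** A conjugacy + dictionary exercise over tree vocabulary: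
* `isGalerkinMode_realTrigPoly_coeffExt x.2` — phase vectors synthesise Galerkin modes;
* `Torus.galerkinFlow_realTrigPoly x.2 t` — the field orbit of `realTrigPoly S x̄` is
  `realTrigPoly S (galerkinCoeffFlow ν f̂|_S t x)‾`, and `galerkinPhaseFlow` coerces to
  `galerkinCoeffFlow` (`coe_galerkinPhaseFlow`, `rfl`);
* with `c' = galerkinCoeffFlow … t x ∈ galerkinSubspace S` (`galerkinCoeffFlow_mem`), the three
  face functionals of `realTrigPoly S c̄'` are the coefficient faces:
  `kineticEnergy_realTrigPoly_coeffExt` (`½ ∑ ‖c' k‖²`), `integral_inner_realTrigPoly_right` +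
  `sum_coeffExt` (`∑ Re ⟪f̂ k, c' k⟫`, local `work_window`), `eGradNormSq_realTrigPoly` +
  `sum_coeffExt` (`ofReal (4π² ∑ |k|² ‖c' k‖²)`, local `eGradNormSq_window`, compared with
  `(G : ℝ≥0∞) = ofReal ↑G` by monotonicity of `ENNReal.ofReal`).

References: J. C. Robinson, J. L. Rodrigo, W. Sadowski, *The three-dimensional Navier–Stokes
equations*, CUP 2016, §4.1 (the Galerkin system and its velocity field); J. K. Hale,
L. T. Magalhães, W. M. Oliva, *Dynamics in Infinite Dimensions*, 2nd ed., Springer 2002, App. A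
(semiflows).
-/

noncomputable section

-- `Summit.<Summit>.<Problem>` is the tree's mandated summit-side namespace (CONVENTIONS §2); deliberate duplicate.
set_option linter.dupNamespace false

namespace Summit.AnomalousDissipation.AnomalousDissipation.Theorems.UniformGalerkinTrap.Sketch

open MeasureTheory Set Filter Topology
open scoped ENNReal NNReal InnerProductSpace
open Literature.Analysis.FunctionSpaces Literature.Analysis.FunctionSpaces.Torus
open Literature.Analysis.FluidPDE

/-! ## The field ↔ coefficient dictionary on the phase space of order `N`

The energy face needs no local lemma: the tree's `kineticEnergy_realTrigPoly_coeffExt` already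
reads `kineticEnergy (realTrigPoly S c̄) = ½ ∑ₖ ‖c k‖²` over the finite type `↥S`. -/

/-- **Work on the phase space**: for `f ∈ L²` and a real divergence-free coefficient vector `c`
on the frequency ball of order `N`,
`∫ ⟪f, realTrigPoly (freqBall N) c̄⟫ = ∑ₖ Re ⟪(f̂|_{≤N}) k, c k⟫_ℂ`
(Parseval against a band-limited field, `integral_inner_realTrigPoly_right`). [folklore] -/
theorem work_window {N : ℕ} {f : UnitAddTorus (Fin 3) → EuclideanSpace ℝ (Fin 3)}
    (hf : MemLp f 2 volume) {c : ↥(freqBall (d := Fin 3) N) → EuclideanSpace ℂ (Fin 3)}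
    (hc : c ∈ galerkinSubspace (freqBall N)) :
    ∫ y, ⟪f y, realTrigPoly (freqBall N) (coeffExt (freqBall N) c) y⟫_ℝ =
      ∑ k : ↥(freqBall (d := Fin 3) N),
        (inner ℂ (fourierRestrict (freqBall (d := Fin 3) N) f k) (c k)).re := by
  rw [integral_inner_realTrigPoly_right neg_mem_freqBall_of_mem
    (hc.1.isConjSymm_coeffExt neg_mem_freqBall_of_mem) hf]
  exact sum_coeffExt
    (fun k v => (inner ℂ (UnitAddTorus.mFourierCoeff (EuclideanSpace.complexify ∘ f) k) v).re) c

/-- **Enstrophy on the phase space**: for a real divergence-free coefficient vector `c` on the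
frequency ball of order `N`,
`eGradNormSq (realTrigPoly (freqBall N) c̄) = ofReal (4π² ∑ₖ |k|² ‖c k‖²)`
(`eGradNormSq_realTrigPoly`). [folklore] -/
theorem eGradNormSq_window {N : ℕ} {c : ↥(freqBall (d := Fin 3) N) → EuclideanSpace ℂ (Fin 3)}
    (hc : c ∈ galerkinSubspace (freqBall N)) :
    eGradNormSq (realTrigPoly (freqBall N) (coeffExt (freqBall N) c)) =
      ENNReal.ofReal (4 * Real.pi ^ 2 * ∑ k : ↥(freqBall (d := Fin 3) N),
        freqNormSq ((k : ↥(freqBall (d := Fin 3) N)) : Fin 3 → ℤ) * ‖c k‖ ^ 2) := by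
  rw [eGradNormSq_realTrigPoly neg_mem_freqBall_of_mem
    (hc.1.isConjSymm_coeffExt neg_mem_freqBall_of_mem),
    sum_coeffExt (fun k v => freqNormSq k * ‖v‖ ^ 2) c]

/-! ## The stub -/

/-- **Trapped phase point ⟹ trapped `galerkinFlow` orbit in the window** (registered stub
`stub_blockToWindow` of line `Sketch`). If the forward orbit of a phase point `x` under
`galerkinPhaseFlow ν (f̂|_{≤N})` keeps `½∑‖c k‖² ≤ E`, `∑ Re⟪f̂ k, c k⟫ ≥ ε₀`,
`4π²∑|k|²‖c k‖² ≤ G`, then its synthesised field `realTrigPoly (freqBall N) x̄` is a Galerkin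
mode of order `N` whose `Torus.galerkinFlow` orbit stays in
`{kineticEnergy ≤ E, (f,·) ≥ ε₀, eGradNormSq ≤ G}` (conjugacy `Torus.galerkinFlow_realTrigPoly` +
dictionary `kineticEnergy_realTrigPoly_coeffExt`, `work_window`, `eGradNormSq_window`). The hypothesis `0 ≤ ν`
of the registered signature is not needed. [folklore] -/
theorem stub_blockToWindow :
    ∀ (ν : ℝ) (N : ℕ) (f : UnitAddTorus (Fin 3) → EuclideanSpace ℝ (Fin 3)) (E ε₀ : ℝ) (G : ℝ≥0)
      (x : ↥(galerkinSubspace (freqBall N : Finset (Fin 3 → ℤ)))), 0 ≤ ν → MemLp f 2 volume →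
      (∀ t : ℝ, 0 ≤ t →
        2⁻¹ * ∑ k, ‖(galerkinPhaseFlow ν (fourierRestrict (freqBall N : Finset (Fin 3 → ℤ)) f) t x :
            ↥(freqBall N : Finset (Fin 3 → ℤ)) → EuclideanSpace ℂ (Fin 3)) k‖ ^ 2 ≤ E ∧
        ε₀ ≤ ∑ k, (inner ℂ (fourierRestrict (freqBall N : Finset (Fin 3 → ℤ)) f k)
            ((galerkinPhaseFlow ν (fourierRestrict (freqBall N : Finset (Fin 3 → ℤ)) f) t x :
              ↥(freqBall N : Finset (Fin 3 → ℤ)) → EuclideanSpace ℂ (Fin 3)) k)).re ∧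
        4 * Real.pi ^ 2 * ∑ k, Torus.freqNormSq ((k : ↥(freqBall N : Finset (Fin 3 → ℤ))) : Fin 3 → ℤ) *
            ‖(galerkinPhaseFlow ν (fourierRestrict (freqBall N : Finset (Fin 3 → ℤ)) f) t x :
              ↥(freqBall N : Finset (Fin 3 → ℤ)) → EuclideanSpace ℂ (Fin 3)) k‖ ^ 2 ≤ (G : ℝ)) →
      IsGalerkinMode N (realTrigPoly (freqBall N : Finset (Fin 3 → ℤ))
          (coeffExt (freqBall N : Finset (Fin 3 → ℤ))
            (x : ↥(freqBall N : Finset (Fin 3 → ℤ)) → EuclideanSpace ℂ (Fin 3)))) ∧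
      ∀ t : ℝ, 0 ≤ t →
        kineticEnergy (Torus.galerkinFlow ν f N t (realTrigPoly (freqBall N : Finset (Fin 3 → ℤ))
          (coeffExt (freqBall N : Finset (Fin 3 → ℤ))
            (x : ↥(freqBall N : Finset (Fin 3 → ℤ)) → EuclideanSpace ℂ (Fin 3))))) ≤ E ∧
        ε₀ ≤ ∫ y, inner ℝ (f y) (Torus.galerkinFlow ν f N t (realTrigPoly (freqBall N : Finset (Fin 3 → ℤ))
          (coeffExt (freqBall N : Finset (Fin 3 → ℤ))
            (x : ↥(freqBall N : Finset (Fin 3 → ℤ)) → EuclideanSpace ℂ (Fin 3)))) y) ∧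
        eGradNormSq (Torus.galerkinFlow ν f N t (realTrigPoly (freqBall N : Finset (Fin 3 → ℤ))
          (coeffExt (freqBall N : Finset (Fin 3 → ℤ))
            (x : ↥(freqBall N : Finset (Fin 3 → ℤ)) → EuclideanSpace ℂ (Fin 3))))) ≤ (G : ℝ≥0∞) := by
  intro ν N f E ε₀ G x _hν hf hblock
  refine ⟨isGalerkinMode_realTrigPoly_coeffExt x.2, fun t ht => ?_⟩
  obtain ⟨hE, hW, hZ⟩ := hblock t ht
  -- the coefficient orbit point and its membership in the phase space
  have hmem : galerkinCoeffFlow ν (fourierRestrict (freqBall (d := Fin 3) N) f) t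
      (x : ↥(freqBall (d := Fin 3) N) → EuclideanSpace ℂ (Fin 3)) ∈
        galerkinSubspace (freqBall (d := Fin 3) N) :=
    galerkinCoeffFlow_mem x.2 t
  -- conjugacy: the field orbit is the synthesised field of the coefficient orbit
  rw [Torus.galerkinFlow_realTrigPoly x.2 t,
    kineticEnergy_realTrigPoly_coeffExt neg_mem_freqBall_of_mem hmem.1, work_window hf hmem,
    eGradNormSq_window hmem, ← ENNReal.ofReal_coe_nnreal]
  exact ⟨hE, hW, ENNReal.ofReal_le_ofReal hZ⟩

end Summit.AnomalousDissipation.AnomalousDissipation.Theorems.UniformGalerkinTrap.Sketch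

end
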